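import Summits.RiemannHypothesis.RiemannHypothesis.Theorems.WeilFormatCWindowPointwise
import Summits.RiemannHypothesis.RiemannHypothesis.Theorems.WeilFormatCWindowCutoff
import Summits.RiemannHypothesis.RiemannHypothesis.Theorems.WeilFormatCWindowGram
import Summits.RiemannHypothesis.RiemannHypothesis.Theorems.WeilFormatCEntryGram
import Literature.NumberTheory.LFunctions.UniformWeilPositivityRH
import HarnessLib

/-!
# Format C is COMPLETE: `WeilPositivityOn a` ⟺ the window form is non-negative on every trigonometric window

Helper file (`--supports stmt-RiemannHypothesis-0098`, lead-track anchor), RH-free, no definitions, no named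
facts. Seat rh-explicit-weil-3 (gen3). The dictionary `weilPositivityOn_of_weilWindowForm_sum_chi_nonneg`
(`WeilFormatCWindowDictionary.lean`) is the direction "certificates ⟹ rung". THIS FILE proves the CONVERSE:
positivity of Weil's functional on `C(a)` (smooth, supported in `[−a, a]`) forces `weilWindowForm a u ≥ 0` for every
bounded window function `u` which is Lipschitz on the closed window and smooth inside it — in particular for every
trigonometric window `Σ c_n χ_n` (which JUMPS at `±a` and is not a test function). Consequences:

* `weilPositivityOn_iff_weilWindowForm_sum_chi_nonneg`: **`WeilPositivityOn a ↔ ∀ N c, 0 ≤ weilWindowForm a (Σ_{|n|≤N} c_n χ_n)`**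
  — format C loses nothing: a rung holds iff ALL Gram truncations are PSD;
* `not_weilPositivityOn_of_weilWindowForm_sum_chi_neg`: ONE coefficient vector with a negative window form refutes the
  rung — the soundness of NEGATIVE format-C certificates (a certified negative eigenvalue of a Gram truncation);
* `sum_mul_mul_gramCoeff_nonneg_of_weilPositivityOn` / `…_of_riemannHypothesis`: under `WeilPositivityOn a` (in
  particular under RH, `riemannHypothesis_iff_forall_weilPositivityOn`) every truncation of Yoshida's matrix
  `gramCoeff a` is positive semidefinite.

Method (Yoshida 1992 §0: "we can extend ( , ) to K(a)"): cut `u` off smoothly INSIDE the window, `g_k = η_k·u ∈ C(a)`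
with the plateaus of `WeilFormatCWindowCutoff.lean` (transition width `ε_k → 0`); `g_k → u` off `{±a}`; the increments
obey `D_t(g_k) ≤ K₁ t` on `(0,1]` uniformly in `k` (`weilIncrement_cutoff_le`) and `≤ 8aS₀²` beyond — the majorant
required by `tendsto_weilWindowForm_of_ae_tendsto_of_le` (`WeilFormatCWindowPointwise.lean`); finally
`weilWindowForm a g_k = Re Q(g_k) ≥ 0` passes to the limit.
-/

set_option autoImplicit false
set_option linter.dupNamespace false  -- the mandated namespace repeats `RiemannHypothesis`

noncomputable section

open Complex Filter Set MeasureTheory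
open scoped Real Topology ComplexConjugate ContDiff

namespace Summit.RiemannHypothesis.RiemannHypothesis.Theorems.WeilFormatC

open Literature.NumberTheory.LFunctions
open Literature.NumberTheory.LFunctions.Yoshida1992 (modes chi chiCore contDiff_chiCore gramCoeff)

variable {a : ℝ}

/-! ## The converse of the dictionary -/

/-- **Positivity on `C(a)` forces the window form to be non-negative on every smooth-inside window function.**
Let `a > 0`, `WeilPositivityOn a`, and let `u` be a window function on `[−a, a]` (measurable, vanishing off the
window, bounded, Lipschitz on the closed window) which agrees on `[−a, a]` with a smooth function `f : ℝ → ℂ`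
(so `u` may JUMP at `±a`). Then `0 ≤ weilWindowForm a u`. -/
theorem weilWindowForm_nonneg_of_weilPositivityOn (ha : 0 < a) (hW : WeilPositivityOn a) {u f : ℝ → ℂ}
    (hu : IsWindowFunction a u) (hf : ContDiff ℝ ∞ f) (huf : ∀ x ∈ Icc (-a) a, u x = f x) :
    0 ≤ weilWindowForm a u := by
  obtain ⟨hum, huz, ⟨S₀, hS₀⟩, ⟨S₁', hS₁'⟩⟩ := hu
  set S₁ := max S₁' 0 with hS₁def
  have hS₁0 : 0 ≤ S₁ := le_max_right _ _
  have hS₁ : ∀ x y, x ∈ Icc (-a) a → y ∈ Icc (-a) a → ‖u y - u x‖ ≤ S₁ * |y - x| := fun x y hx hy ↦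
    (hS₁' x y hx hy).trans (mul_le_mul_of_nonneg_right (le_max_left _ _) (abs_nonneg _))
  have hS₀0 : 0 ≤ S₀ := (norm_nonneg _).trans (hS₀ 0)
  obtain ⟨C, hC0, hC⟩ := exists_lipschitz_smoothTransition
  -- transition widths `ε_k = a/(2(k+2)) → 0`, `2ε_k ≤ a`
  set ε : ℕ → ℝ := fun k ↦ a / ((k : ℝ) + 2) / 2 with hεdef
  have hε : ∀ k, 0 < ε k := fun k ↦ by positivity
  have h2ε : ∀ k, 2 * ε k ≤ a := fun k ↦ by
    have : a / ((k : ℝ) + 2) ≤ a := div_le_self ha.le (by linarith [(Nat.cast_nonneg k : (0 : ℝ) ≤ k)])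
    show 2 * (a / ((k : ℝ) + 2) / 2) ≤ a
    linarith
  have hεto : Tendsto ε atTop (𝓝 0) := by
    have h1 : Tendsto (fun k : ℕ ↦ a / ((k : ℝ) + 2)) atTop (𝓝 0) :=
      tendsto_const_nhds.div_atTop (tendsto_atTop_add_const_right _ _ tendsto_natCast_atTop_atTop)
    simpa [hεdef] using h1.div_const 2
  choose η hηs hη01 hη1 hη0 hηL using fun k ↦ exists_smooth_plateau (a := a) (hε k) hC
  have hηm : ∀ k, Measurable (η k) := fun k ↦ (hηs k).continuous.measurable
  -- the approximants `g_k = η_k · f = η_k · u ∈ C(a)`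
  set g : ℕ → ℝ → ℂ := fun k x ↦ (η k x : ℂ) * f x with hgdef
  have hgu : ∀ k x, g k x = (η k x : ℂ) * u x := by
    intro k x
    by_cases hx : x ∈ Icc (-a) a
    · simp only [hgdef, huf x hx]
    · have hxa : a - ε k ≤ |x| := by
        have : a < |x| := lt_abs_of_not_mem_Icc_window hx
        linarith [hε k]
      simp only [hgdef, hη0 k x hxa, Complex.ofReal_zero, zero_mul]
  have hgu' : ∀ k, g k = fun x ↦ (η k x : ℂ) * u x := fun k ↦ funext (hgu k)
  have hgz : ∀ k x, x ∉ Icc (-a) a → g k x = 0 := fun k x hx ↦ by rw [hgu, huz x hx, mul_zero]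
  have hgb : ∀ k x, ‖g k x‖ ≤ S₀ := fun k x ↦ by
    rw [hgu, norm_mul, Complex.norm_real, Real.norm_eq_abs, abs_of_nonneg (hη01 k x).1]
    calc η k x * ‖u x‖ ≤ 1 * S₀ := by
          gcongr
          · exact (hη01 k x).2
          · exact hS₀ x
      _ = S₀ := one_mul _
  have hofR : ContDiff ℝ ∞ (fun x : ℝ ↦ (x : ℂ)) := Complex.ofRealCLM.contDiff
  have hgsmooth : ∀ k, ContDiff ℝ ∞ (g k) := fun k ↦ (hofR.comp (hηs k)).mul hf
  have hgm : ∀ k, Measurable (g k) := fun k ↦ (hgsmooth k).continuous.measurable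
  have hgsupp : ∀ k, tsupport (g k) ⊆ Icc (-a) a := fun k ↦
    closure_minimal (fun x hx ↦ by_contra fun h ↦ hx (hgz k x h)) isClosed_Icc
  have hgtest : ∀ k, IsWeilTest (g k) := fun k ↦
    ⟨hgsmooth k, HasCompactSupport.intro isCompact_Icc (hgz k)⟩
  have hpos : ∀ k, 0 ≤ weilWindowForm a (g k) := fun k ↦ by
    rw [weilWindowForm_eq_re_weilQuadratic (hgtest k) (hgsupp k)]
    exact hW (g k) (hgtest k) (hgsupp k)
  -- almost-everywhere convergence `g_k → u` (everywhere off `{a, −a}`)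
  have hpt : ∀ᵐ x : ℝ, Tendsto (fun k ↦ g k x) atTop (𝓝 (u x)) := by
    have hnull : ∀ᵐ x : ℝ, x ∈ ({a, -a} : Set ℝ)ᶜ :=
      compl_mem_ae_iff.2 ((Set.toFinite _).measure_zero _)
    refine hnull.mono fun x hx ↦ ?_
    simp only [mem_compl_iff, mem_insert_iff, mem_singleton_iff, not_or] at hx
    rcases lt_or_ge a |x| with hxa | hxa
    · have hx' : x ∉ Icc (-a) a := fun h ↦ by
        have := abs_le.2 ⟨h.1, h.2⟩; linarith
      rw [huz x hx']
      exact tendsto_const_nhds.congr' (Eventually.of_forall fun k ↦ (hgz k x hx').symm)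
    · have hlt : |x| < a := lt_of_le_of_ne hxa fun h ↦ by
        rcases (abs_eq ha.le).1 h with h' | h'
        · exact hx.1 h'
        · exact hx.2 h'
      have hr : (0 : ℝ) < (a - |x|) / 2 := by linarith
      have hev : ∀ᶠ k in atTop, u x = g k x := by
        filter_upwards [hεto.eventually (gt_mem_nhds hr)] with k hk
        rw [hgu, hη1 k x (by linarith), Complex.ofReal_one, one_mul]
      exact tendsto_const_nhds.congr' hev
  -- the archimedean majorant, uniform in `k`
  set Λ : ℝ := a * S₁ + 2 * C * S₀ with hΛ
  set K₁ : ℝ := 4 * a * S₁ ^ 2 + 4 * S₀ ^ 2 + 8 * (2 * Λ ^ 2 + 10 * S₀ ^ 2) with hK₁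
  set K₂ : ℝ := 8 * a * S₀ ^ 2 with hK₂
  set cst : ℝ := max (K₁ / 2) (K₂ / (8 * a)) with hcst
  have hdom : ∀ k t, 0 < t → weilIncrement (g k) t ≤ cst * (if t ≤ 1 then 2 * t else 8 * a) := by
    intro k t ht
    by_cases ht1 : t ≤ 1
    · rw [if_pos ht1]
      have hmain := weilIncrement_cutoff_le ha (hε k) (h2ε k) hum huz hS₀ hS₁ hS₁0 hC0 (hηm k) (hη01 k)
        (hη1 k) (hηL k) ht
      rw [← hgu' k] at hmain
      have ht2 : t ^ 2 ≤ t := by nlinarith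
      have h3 : 4 * a * S₁ ^ 2 * t ^ 2 ≤ 4 * a * S₁ ^ 2 * t := mul_le_mul_of_nonneg_left ht2 (by positivity)
      calc weilIncrement (g k) t ≤ K₁ * t := by
            rw [hK₁, hΛ]; linarith [hmain, h3]
        _ = K₁ / 2 * (2 * t) := by ring
        _ ≤ cst * (2 * t) := by gcongr; exact le_max_left _ _
    · rw [if_neg ht1]
      calc weilIncrement (g k) t ≤ 8 * a * S₀ ^ 2 := weilIncrement_le_window_const ha.le (hgm k) (hgz k) (hgb k) t
        _ = K₂ / (8 * a) * (8 * a) := by rw [hK₂]; field_simp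
        _ ≤ cst * (8 * a) := by gcongr; exact le_max_right _ _
  have hM : IntegrableOn (fun t ↦ weilArchDensity t * (cst * (if t ≤ 1 then 2 * t else 8 * a))) (Ioi 0) := by
    have h0 := integrableOn_archBound ha.le (1 : ℝ) (0 : ℝ)
    have h1 : IntegrableOn (fun t : ℝ ↦ weilArchDensity t * (if t ≤ 1 then 2 * t else 8 * a)) (Ioi 0) :=
      h0.congr_fun (fun t _ ↦ by norm_num) measurableSet_Ioi
    exact IntegrableOn.congr_fun (h1.const_mul cst) (fun t _ ↦ by ring) measurableSet_Ioi
  exact ge_of_tendsto' (tendsto_weilWindowForm_of_ae_tendsto_of_le hgm hgz hgb hpt hM hdom a) hpos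

/-- **Every trigonometric window has non-negative window form under `WeilPositivityOn a`** (`a > 0`; any finite
set of modes). -/
theorem weilWindowForm_sum_smul_chi_nonneg_of_weilPositivityOn (ha : 0 < a) (hW : WeilPositivityOn a)
    (s : Finset ℤ) (c : ℤ → ℂ) : 0 ≤ weilWindowForm a (∑ n ∈ s, c n • chi a n) := by
  refine weilWindowForm_nonneg_of_weilPositivityOn ha hW (f := fun x ↦ ∑ n ∈ s, c n • chiCore a n x)
    (IsWindowFunction.sum s c fun n _ ↦ isWindowFunction_chi ha n)
    (ContDiff.sum fun n _ ↦ (contDiff_chiCore a n).const_smul (c n)) fun x hx ↦ ?_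
  simp only [Finset.sum_apply, Pi.smul_apply, chi, indicator_of_mem hx]

/-- Members of Yoshida's space `K(a)` (restrictions of smooth `2a`-periodic functions to the closed window) are
window functions. -/
theorem isWindowFunction_of_mem_K {φ : ℝ → ℂ} (hφ : φ ∈ Yoshida1992.K a) : IsWindowFunction a φ := by
  obtain ⟨f, hf, -, hφf, hφ0⟩ := hφ
  have hind : φ = (Icc (-a) a).indicator f := by
    funext x
    by_cases hx : x ∈ Icc (-a) a
    · rw [indicator_of_mem hx, hφf x (abs_le.2 ⟨hx.1, hx.2⟩)]
    · rw [indicator_of_notMem hx, hφ0 x (lt_abs_of_not_mem_Icc_window hx)]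
  obtain ⟨S, hS⟩ := (isCompact_Icc (a := -a) (b := a)).exists_bound_of_continuousOn
    hf.continuous.continuousOn
  have hf'c : Continuous (deriv f) := hf.continuous_deriv (by simp)
  obtain ⟨L, hL⟩ := (isCompact_Icc (a := -a) (b := a)).exists_bound_of_continuousOn hf'c.continuousOn
  have hdiff : Differentiable ℝ f := hf.differentiable (by simp)
  refine ⟨?_, fun x hx ↦ hφ0 x (lt_abs_of_not_mem_Icc_window hx), ⟨max S 0, fun x ↦ ?_⟩,
    ⟨max L 0, fun x y hx hy ↦ ?_⟩⟩
  · rw [hind]; exact hf.continuous.measurable.indicator measurableSet_Icc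
  · rw [hind]
    by_cases hx : x ∈ Icc (-a) a
    · rw [indicator_of_mem hx]; exact (hS x hx).trans (le_max_left _ _)
    · rw [indicator_of_notMem hx, norm_zero]; exact le_max_right _ _
  · rw [hφf x (abs_le.2 ⟨hx.1, hx.2⟩), hφf y (abs_le.2 ⟨hy.1, hy.2⟩)]
    have h := (convex_Icc (-a) a).norm_image_sub_le_of_norm_deriv_le (C := max L (0 : ℝ))
      (fun z _ ↦ hdiff.differentiableAt) (fun z hz ↦ (hL z hz).trans (le_max_left L (0 : ℝ))) hx hy
    simpa only [Real.norm_eq_abs] using h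

/-- **Positivity on `C(a)` ⟹ positivity of the window form on all of `K(a)`** (Yoshida's extension of `( , )` to
`K(a)`, 1992 §0): `0 ≤ weilWindowForm a φ` for every `φ ∈ K(a)` under `WeilPositivityOn a` (`a > 0`). -/
theorem weilWindowForm_nonneg_of_weilPositivityOn_of_mem_K (ha : 0 < a) (hW : WeilPositivityOn a) {φ : ℝ → ℂ}
    (hφ : φ ∈ Yoshida1992.K a) : 0 ≤ weilWindowForm a φ := by
  have hwin := isWindowFunction_of_mem_K hφ
  obtain ⟨f, hf, -, hφf, -⟩ := hφ
  exact weilWindowForm_nonneg_of_weilPositivityOn ha hW hwin hf fun x hx ↦ hφf x (abs_le.2 ⟨hx.1, hx.2⟩)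

/-- **`WeilPositivityOn a` ⟺ the window form is non-negative on `K(a)`** (`a > 0`): positivity on the cone `C(a)`
and on Yoshida's larger space `K(a)` are EQUIVALENT. -/
theorem weilPositivityOn_iff_forall_mem_K (ha : 0 < a) :
    WeilPositivityOn a ↔ ∀ φ ∈ Yoshida1992.K a, 0 ≤ weilWindowForm a φ :=
  ⟨fun hW _ hφ ↦ weilWindowForm_nonneg_of_weilPositivityOn_of_mem_K ha hW hφ,
    fun h ↦ weilPositivityOn_of_weilWindowForm_sum_chi_nonneg ha fun _ c ↦
      h _ (Submodule.sum_mem _ fun n _ ↦ Submodule.smul_mem _ (c n) (Yoshida1992.chi_mem_K a n))⟩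

/-- **FORMAT C IS COMPLETE**: for `a > 0`, `WeilPositivityOn a` holds if and only if the window form is
non-negative on every trigonometric window `Σ_{|n|≤N} c_n χ_n` (the dictionary
`weilPositivityOn_of_weilWindowForm_sum_chi_nonneg` and its converse). -/
theorem weilPositivityOn_iff_weilWindowForm_sum_chi_nonneg (ha : 0 < a) :
    WeilPositivityOn a ↔ ∀ (N : ℕ) (c : ℤ → ℂ), 0 ≤ weilWindowForm a (∑ n ∈ modes N, c n • chi a n) :=
  ⟨fun hW N c ↦ weilWindowForm_sum_smul_chi_nonneg_of_weilPositivityOn ha hW (modes N) c,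
    weilPositivityOn_of_weilWindowForm_sum_chi_nonneg ha⟩

/-- **Soundness of NEGATIVE format-C certificates**: one coefficient vector on finitely many modes with a
negative window form refutes `WeilPositivityOn a`. -/
theorem not_weilPositivityOn_of_weilWindowForm_sum_chi_neg (ha : 0 < a) {s : Finset ℤ} {c : ℤ → ℂ}
    (h : weilWindowForm a (∑ n ∈ s, c n • chi a n) < 0) : ¬ WeilPositivityOn a :=
  fun hW ↦ not_lt.2 (weilWindowForm_sum_smul_chi_nonneg_of_weilPositivityOn ha hW s c) h

/-- **Under `WeilPositivityOn a` every truncation of Yoshida's matrix is positive semidefinite**: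
`0 ≤ Σ_{n,m∈s} x_n x_m · gramCoeff a n m` for every finite `s ⊆ ℤ` and every real vector `x`. -/
theorem sum_mul_mul_gramCoeff_nonneg_of_weilPositivityOn (ha : 0 < a) (hW : WeilPositivityOn a)
    (s : Finset ℤ) (x : ℤ → ℝ) : 0 ≤ ∑ n ∈ s, ∑ m ∈ s, x n * x m * gramCoeff a n m := by
  have h := weilWindowForm_sum_smul_chi_nonneg_of_weilPositivityOn ha hW s (fun n ↦ (x n : ℂ))
  rw [weilWindowForm_sum_smul_chi_eq_gramCoeff ha] at h
  refine h.trans_eq (Finset.sum_congr rfl fun n _ ↦ Finset.sum_congr rfl fun m _ ↦ ?_)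
  rw [Complex.conj_ofReal, ← Complex.ofReal_mul, Complex.ofReal_re]

/-- **Under RH every truncation of Yoshida's matrix is positive semidefinite, for every window `a > 0`**
(`riemannHypothesis_iff_forall_weilPositivityOn`): a certified negative eigenvalue of one truncation would
refute RH. -/
theorem sum_mul_mul_gramCoeff_nonneg_of_riemannHypothesis (hRH : RiemannHypothesis) (ha : 0 < a)
    (s : Finset ℤ) (x : ℤ → ℝ) : 0 ≤ ∑ n ∈ s, ∑ m ∈ s, x n * x m * gramCoeff a n m :=
  sum_mul_mul_gramCoeff_nonneg_of_weilPositivityOn ha (riemannHypothesis_iff_forall_weilPositivityOn.1 hRH a ha) s x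

end Summit.RiemannHypothesis.RiemannHypothesis.Theorems.WeilFormatC

end
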